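import Summits.QuantumFields.YangMills.Theorems.TwistedTraceScaling.Negative.ActionWindowSchedule
import Summits.QuantumFields.YangMills.Theorems.LuscherReductionTwistedTraceScalingBTRatesKappa
import HarnessLib

/-!
# R53R (crux `TwistedTraceScaling`, stmt-QuantumFields-20203): the smearing exponent of lane A's (C1) RECORD on schedule B — as PROPOSED (`σ = β^{-1/3}`,
# p703178 `…BOCentralRecord.central_transfer_record`) it cannot feed `hb_small`; with the ONE-constant repair `σ := β^{-1/2}` the WHOLE exponent fits the (OD) budget

Standing disprover `ym-cdisprove-20203-1` (gen 42), sequel to R53 (`…Negative.ActionWindowSchedule`).  Lane A's record (pub draft 2026-08-29T06:26Z = proposal p703178)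
carries the smearing prefactors `e^{∓η₀}` with, VERBATIM,
`η₀(β) = coreEta L β 0 (powScale (1/3) β) T(β) r_f(β) (powScale 1 β·|Site|) (powScale (1/3) β) + coreEps1 L β 0 T(β) r_f(β) + coreEps2 L β 0 T(β) r_f(β) (powScale (1/3) β)`,
`T(β) = 9L·(5·powScale(1/2)β·ℓ²) + powScale 1 β`, `r_f(β) = min (1/40) (powScale(1/2)β·ℓ)`, `ℓ = btLog β`.  The (B-OD) door built from the record has relative error
`≥ hi/lo − 1 ≥ e^{η₀} − 1 ≥ η₀`, and the package field it must meet is `hb_small : ∀ a > 0, ∀ᶠ β, b_OD(β)² ≤ a·λ_b(L³β)` (`…BOAssemblyBricks`).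
* §1 `coreEta_le_recordExponent` (`coreEps1 = 0` at `δ = 0`, `coreEps2 ≥ 0`), ★★★ `record_budget_false` (every real `ε, θ`:
  `¬ ∃ β₀ ∀ β ≥ β₀ ∃ b, η₀(β) ≤ b ∧ b² ≤ εθλ_b(L³β)/16`), ★★★ `not_hb_small_of_recordExponent` (`η₀ ≤ b_OD` eventually ⇒ `¬ hb_small`),
  `not_hb_small_of_exp_recordExponent` (`e^{η₀} − 1 ≤ b_OD` eventually ⇒ `¬ hb_small`), `not_hb_small_recordExponent_self` (`b_OD := η₀` itself fails) — all from R53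
  `not_hb_small_of_action_third` (the action floor `1728N_P·βT²·√σ ≥ A·ℓ⁴·β^{-1/6}`).
* §2 THE REPAIR IS COMPLETE FOR THE EXPONENT: with `σ := powScale (1/2) β` and everything else as in the record, ★★ `repaired_recordExponent_le`:
  `η₀'(β) ≤ (45L+1)⁴·ℓ⁸·powScale (1/4) β·(750|E| + 5140N₃ + 2193291N_P)` for `β ≥ 1` (every summand priced: `558|E|βT²δu²`, `192|E|βT²δu`, `(50+50)N₃σβr_f²`, `5040N₃δuβr_f²`,
  `2N_P·1728βT²√σ`, `3N_P(29376βT²T + 700569βT²T²)` (`stepActionErr T σ` twice + `stepActionErr T 0` once); `βT² ≤ (45L+1)²ℓ⁴`, `βr_f² ≤ ℓ²`, `√σ = β^{-1/4}`), hence ★★ `repaired_recordExponent_affordable`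
  (`∃ β₀ ∀ β ≥ β₀ ∃ b, η₀' ≤ b ∧ b² ≤ εθλ_b/16`, every `ε, θ > 0`; R50T `polylog_window_affordable`, `m = 8`, `s = 1/4 > 1/6`) and ★★ `repaired_recordExponent_hb_small`
  (`∀ a > 0, ∀ᶠ β, η₀'(β)² ≤ a·λ_b(L³β)`): the exponent-level obstruction of §1 disappears; what `b_OD` must then still absorb (`(P)`'s `C_pβ^{-1/2}`, the Gaussian-constant
  ratios, the tails `e^{-Ω(ℓ²)}`) is lane A's rate file.
READING: bookkeeping on ONE schedule constant of a record that is TRUE as stated (p703178 is an honest theorem for every `σ`); nothing landed is refuted.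
HONEST FRAMING: stub of a child of the CONDITIONAL reduction route R2b1; (C1) rate, (C4), (C5), (B-ST), C4-CORE OPEN; not infinite volume, not a gap, not Clay.
-/

set_option autoImplicit false

noncomputable section

open Real Filter
open Literature.MathematicalPhysics.QuantumFieldTheory
open Literature.MathematicalPhysics.QuantumLattice
open Summit.QuantumFields.YangMills.Theorems.FemtoTransferGap
open Summit.QuantumFields.YangMills.Theorems.FemtoTransferGap.TwoLattice
open Summit.QuantumFields.YangMills.Theorems.FemtoTransferGap.TwoLattice.Cov (stepActionErr stepActionErr_nonneg)
open Summit.QuantumFields.YangMills.Theorems.FemtoTransferGap.TwoLattice.ConstTube (coreEta coreEps1 coreEps2 btLog one_le_btLog schedT_le eventually_btLog_eq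
  mul_powScale_half_sq coreEps1_nonneg coreEps2_nonneg coreEta_nonneg)
open Summit.QuantumFields.YangMills.Theorems.TwistedTraceScaling.Negative

namespace Summit.QuantumFields.YangMills.Theorems.TwistedTraceScaling.Negative.R53R

variable {L : ℕ} [NeZero L]

/-! ## §1 The record as proposed (`σ = powScale (1/3) β`): the whole exponent inherits R53's obstruction -/

/-- `coreEta ≤ η₀ = coreEta + coreEps1 + coreEps2` on the record's data (`β ≥ 0`; `coreEps1, coreEps2 ≥ 0`). [folklore] -/
theorem coreEta_le_recordExponent {β σ : ℝ} (hβ : 0 ≤ β) (hσ : 0 ≤ σ) :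
    coreEta L β 0 (powScale (1 / 3) β) (9 * (L : ℝ) * (5 * (powScale (1 / 2) β * btLog β ^ 2)) + powScale 1 β)
        (min (1 / 40) (powScale (1 / 2) β * btLog β)) (powScale 1 β * Fintype.card (Site 3 L)) σ ≤
      coreEta L β 0 (powScale (1 / 3) β) (9 * (L : ℝ) * (5 * (powScale (1 / 2) β * btLog β ^ 2)) + powScale 1 β)
          (min (1 / 40) (powScale (1 / 2) β * btLog β)) (powScale 1 β * Fintype.card (Site 3 L)) σ +
        coreEps1 L β 0 (9 * (L : ℝ) * (5 * (powScale (1 / 2) β * btLog β ^ 2)) + powScale 1 β) (min (1 / 40) (powScale (1 / 2) β * btLog β)) +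
        coreEps2 L β 0 (9 * (L : ℝ) * (5 * (powScale (1 / 2) β * btLog β ^ 2)) + powScale 1 β) (min (1 / 40) (powScale (1 / 2) β * btLog β)) σ := by
  have hT0 := R52.schedT_nonneg (L := L) β
  have h1 := coreEps1_nonneg (L := L) (δ := 0) (R := min (1 / 40) (powScale (1 / 2) β * btLog β)) hβ le_rfl hT0
  have h2 := coreEps2_nonneg (L := L) (δ := 0) (R := min (1 / 40) (powScale (1 / 2) β * btLog β)) hβ hT0 hσ
  linarith

/-- `0 ≤ η₀` on the record's data (`β ≥ 0`, `σ ≥ 0`). [folklore] -/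
theorem recordExponent_nonneg {β σ : ℝ} (hβ : 0 ≤ β) (hσ : 0 ≤ σ) :
    0 ≤ coreEta L β 0 (powScale (1 / 3) β) (9 * (L : ℝ) * (5 * (powScale (1 / 2) β * btLog β ^ 2)) + powScale 1 β)
          (min (1 / 40) (powScale (1 / 2) β * btLog β)) (powScale 1 β * Fintype.card (Site 3 L)) σ +
        coreEps1 L β 0 (9 * (L : ℝ) * (5 * (powScale (1 / 2) β * btLog β ^ 2)) + powScale 1 β) (min (1 / 40) (powScale (1 / 2) β * btLog β)) +
        coreEps2 L β 0 (9 * (L : ℝ) * (5 * (powScale (1 / 2) β * btLog β ^ 2)) + powScale 1 β) (min (1 / 40) (powScale (1 / 2) β * btLog β)) σ := by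
  have hT0 := R52.schedT_nonneg (L := L) β
  have h0 := coreEta_nonneg (L := L) (δ := 0) (α := powScale (1 / 3) β) (R := min (1 / 40) (powScale (1 / 2) β * btLog β))
    (Γ := powScale 1 β * Fintype.card (Site 3 L)) (σ := σ) hβ le_rfl (powScale_pos _ _).le hT0
    (mul_nonneg (powScale_pos _ _).le (Nat.cast_nonneg _)) hσ
  linarith [coreEta_le_recordExponent (L := L) hβ hσ]

/-- ★★★ **THE RECORD'S EXPONENT KILLS THE (OD) BUDGET CLAUSE** (`σ = powScale (1/3) β`; every real `ε, θ`). [cite: Luscher1983, §3] -/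
theorem record_budget_false (ε θ : ℝ) :
    ¬ ∃ β0 : ℝ, ∀ β : ℝ, β0 ≤ β → ∃ b : ℝ,
      coreEta L β 0 (powScale (1 / 3) β) (9 * (L : ℝ) * (5 * (powScale (1 / 2) β * btLog β ^ 2)) + powScale 1 β)
            (min (1 / 40) (powScale (1 / 2) β * btLog β)) (powScale 1 β * Fintype.card (Site 3 L)) (powScale (1 / 3) β) +
          coreEps1 L β 0 (9 * (L : ℝ) * (5 * (powScale (1 / 2) β * btLog β ^ 2)) + powScale 1 β) (min (1 / 40) (powScale (1 / 2) β * btLog β)) +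
          coreEps2 L β 0 (9 * (L : ℝ) * (5 * (powScale (1 / 2) β * btLog β ^ 2)) + powScale 1 β) (min (1 / 40) (powScale (1 / 2) β * btLog β))
            (powScale (1 / 3) β) ≤ b ∧
        b ^ 2 ≤ ε * θ * bareLambda ((L : ℝ) ^ 3 * β) / 16 := by
  rintro ⟨β0, h⟩
  refine R53.sched_action_budget_false_at_third (L := L) (δu := fun β => powScale (1 / 3) β) (R := fun β => min (1 / 40) (powScale (1 / 2) β * btLog β))
    (Γ := fun β => powScale 1 β * Fintype.card (Site 3 L)) (fun β => (powScale_pos _ _).le) ε θ ⟨max β0 0, fun β hβ => ?_⟩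
  obtain ⟨b, hb, hb2⟩ := h β ((le_max_left _ _).trans hβ)
  exact ⟨b, (coreEta_le_recordExponent (L := L) ((le_max_right _ _).trans hβ) (powScale_pos _ _).le).trans hb, hb2⟩

/-- ★★★ **`hb_small` FAILS FOR EVERY OFF-DIAGONAL CONSTANT DOMINATING THE RECORD'S EXPONENT.** [cite: Luscher1983, §3] -/
theorem not_hb_small_of_recordExponent {bOD : ℝ → ℝ}
    (hfloor : ∀ᶠ β : ℝ in atTop,
      coreEta L β 0 (powScale (1 / 3) β) (9 * (L : ℝ) * (5 * (powScale (1 / 2) β * btLog β ^ 2)) + powScale 1 β)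
            (min (1 / 40) (powScale (1 / 2) β * btLog β)) (powScale 1 β * Fintype.card (Site 3 L)) (powScale (1 / 3) β) +
          coreEps1 L β 0 (9 * (L : ℝ) * (5 * (powScale (1 / 2) β * btLog β ^ 2)) + powScale 1 β) (min (1 / 40) (powScale (1 / 2) β * btLog β)) +
          coreEps2 L β 0 (9 * (L : ℝ) * (5 * (powScale (1 / 2) β * btLog β ^ 2)) + powScale 1 β) (min (1 / 40) (powScale (1 / 2) β * btLog β))
            (powScale (1 / 3) β) ≤ bOD β) :
    ¬ ∀ a : ℝ, 0 < a → ∀ᶠ β : ℝ in atTop, bOD β ^ 2 ≤ a * bareLambda ((L : ℝ) ^ 3 * β) := by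
  refine R53.not_hb_small_of_action_third (L := L) (δu := fun β => powScale (1 / 3) β) (R := fun β => min (1 / 40) (powScale (1 / 2) β * btLog β))
    (Γ := fun β => powScale 1 β * Fintype.card (Site 3 L)) (fun β => (powScale_pos _ _).le) ?_
  filter_upwards [hfloor, eventually_ge_atTop (0 : ℝ)] with β hb hβ
  exact (coreEta_le_recordExponent (L := L) hβ (powScale_pos _ _).le).trans hb

/-- … in particular for the one-sided relative error `e^{η₀} − 1 ≤ b_OD` (`x ≤ e^x − 1`). [folklore] -/
theorem not_hb_small_of_exp_recordExponent {bOD : ℝ → ℝ}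
    (hfloor : ∀ᶠ β : ℝ in atTop,
      Real.exp (coreEta L β 0 (powScale (1 / 3) β) (9 * (L : ℝ) * (5 * (powScale (1 / 2) β * btLog β ^ 2)) + powScale 1 β)
            (min (1 / 40) (powScale (1 / 2) β * btLog β)) (powScale 1 β * Fintype.card (Site 3 L)) (powScale (1 / 3) β) +
          coreEps1 L β 0 (9 * (L : ℝ) * (5 * (powScale (1 / 2) β * btLog β ^ 2)) + powScale 1 β) (min (1 / 40) (powScale (1 / 2) β * btLog β)) +
          coreEps2 L β 0 (9 * (L : ℝ) * (5 * (powScale (1 / 2) β * btLog β ^ 2)) + powScale 1 β) (min (1 / 40) (powScale (1 / 2) β * btLog β))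
            (powScale (1 / 3) β)) - 1 ≤ bOD β) :
    ¬ ∀ a : ℝ, 0 < a → ∀ᶠ β : ℝ in atTop, bOD β ^ 2 ≤ a * bareLambda ((L : ℝ) ^ 3 * β) := by
  refine not_hb_small_of_recordExponent (L := L) ?_
  filter_upwards [hfloor] with β hb
  exact le_trans (by linarith [Real.add_one_le_exp (coreEta L β 0 (powScale (1 / 3) β) (9 * (L : ℝ) * (5 * (powScale (1 / 2) β * btLog β ^ 2)) + powScale 1 β)
            (min (1 / 40) (powScale (1 / 2) β * btLog β)) (powScale 1 β * Fintype.card (Site 3 L)) (powScale (1 / 3) β) +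
          coreEps1 L β 0 (9 * (L : ℝ) * (5 * (powScale (1 / 2) β * btLog β ^ 2)) + powScale 1 β) (min (1 / 40) (powScale (1 / 2) β * btLog β)) +
          coreEps2 L β 0 (9 * (L : ℝ) * (5 * (powScale (1 / 2) β * btLog β ^ 2)) + powScale 1 β) (min (1 / 40) (powScale (1 / 2) β * btLog β))
            (powScale (1 / 3) β))]) hb

/-- Even the smallest conceivable packaging `b_OD := η₀` violates `hb_small`. [folklore] -/
theorem not_hb_small_recordExponent_self :
    ¬ ∀ a : ℝ, 0 < a → ∀ᶠ β : ℝ in atTop,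
      (coreEta L β 0 (powScale (1 / 3) β) (9 * (L : ℝ) * (5 * (powScale (1 / 2) β * btLog β ^ 2)) + powScale 1 β)
            (min (1 / 40) (powScale (1 / 2) β * btLog β)) (powScale 1 β * Fintype.card (Site 3 L)) (powScale (1 / 3) β) +
          coreEps1 L β 0 (9 * (L : ℝ) * (5 * (powScale (1 / 2) β * btLog β ^ 2)) + powScale 1 β) (min (1 / 40) (powScale (1 / 2) β * btLog β)) +
          coreEps2 L β 0 (9 * (L : ℝ) * (5 * (powScale (1 / 2) β * btLog β ^ 2)) + powScale 1 β) (min (1 / 40) (powScale (1 / 2) β * btLog β))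
            (powScale (1 / 3) β)) ^ 2 ≤ a * bareLambda ((L : ℝ) ^ 3 * β) :=
  not_hb_small_of_recordExponent (L := L) (Filter.Eventually.of_forall fun _ => le_rfl)

/-! ## §2 The repaired record (`σ := powScale (1/2) β`, all else unchanged): the WHOLE exponent is `O(L¹⁰·ℓ⁸·β^{-1/4})` and fits the budget -/

/-- Scale facts at `β ≥ 1`: `w = β^{-1/4}`, `x = β^{-1/2} = w²`, `√x = w`, `d = β^{-1/3} ≤ w`, `βx² = 1`. [folklore] -/
theorem scale_facts {β : ℝ} (hβ : 1 ≤ β) :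
    0 < powScale (1 / 4) β ∧ powScale (1 / 4) β ≤ 1 ∧ powScale (1 / 2) β = powScale (1 / 4) β ^ 2 ∧
      Real.sqrt (powScale (1 / 2) β) = powScale (1 / 4) β ∧ 0 < powScale (1 / 3) β ∧ powScale (1 / 3) β ≤ powScale (1 / 4) β ∧
      powScale (1 / 3) β ≤ 1 ∧ β * powScale (1 / 2) β ^ 2 = 1 := by
  refine ⟨powScale_pos _ _, powScale_le_one (by norm_num) β, ?_, ?_, powScale_pos _ _, powScale_le_powScale (by norm_num) β,
    powScale_le_one (by norm_num) β, mul_powScale_half_sq hβ⟩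
  · rw [R21.powScale_sq]; norm_num
  · rw [R50.sqrt_powScale]; norm_num

/-- The polynomial bookkeeping behind `repaired_recordExponent_le` (pure real algebra: every summand `≤ const·K⁴ℓ⁸w`). [folklore] -/
theorem exponent_poly_bound {β T d x w rf ℓ K E N P : ℝ} (hℓ : 1 ≤ ℓ) (hK : 1 ≤ K) (hE : 0 ≤ E) (hN : 0 ≤ N) (hP : 0 ≤ P)
    (hw0 : 0 ≤ w) (hw1 : w ≤ 1) (hx : x = w ^ 2) (hd0 : 0 ≤ d) (hd1 : d ≤ 1) (hdw : d ≤ w) (hβ : 1 ≤ β)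
    (hT0 : 0 ≤ T) (hT : T ≤ K * (x * ℓ ^ 2)) (hβT : β * T ^ 2 ≤ K ^ 2 * ℓ ^ 4) (hβrf : β * rf ^ 2 ≤ ℓ ^ 2) :
    558 * E * (β * T ^ 2) * d ^ 2 + 192 * E * (β * T ^ 2) * d + 100 * N * x * (β * rf ^ 2) + 5040 * N * d * (β * rf ^ 2) +
          3456 * P * (β * T ^ 2) * w + 88128 * P * (β * T ^ 2) * T + 2101707 * P * (β * T ^ 2) * T ^ 2 ≤
      K ^ 4 * ℓ ^ 8 * w * (750 * E + 5140 * N + 2193291 * P) := by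
  have hβ0 : 0 ≤ β := by linarith
  have hA0 : 0 ≤ β * T ^ 2 := by positivity
  have hB0 : 0 ≤ β * rf ^ 2 := by positivity
  have hx0 : 0 ≤ x := by rw [hx]; positivity
  have hxw : x ≤ w := by rw [hx]; nlinarith
  have hx1 : x ≤ 1 := hxw.trans hw1
  have hx2w : x ^ 2 ≤ w := (pow_le_of_le_one hx0 hx1 (by norm_num)).trans hxw
  have hd2w : d ^ 2 ≤ w := (pow_le_of_le_one hd0 hd1 (by norm_num)).trans hdw
  have hK0 : 0 ≤ K := by linarith
  have hℓ0 : 0 ≤ ℓ := by linarith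
  have hKx : 0 ≤ K * (x * ℓ ^ 2) := by positivity
  -- powers of `K, ℓ` up to the common `K⁴ℓ⁸`
  have hK2 : K ^ 2 ≤ K ^ 4 := pow_le_pow_right₀ hK (by norm_num)
  have hK3 : K ^ 3 ≤ K ^ 4 := pow_le_pow_right₀ hK (by norm_num)
  have hℓ2 : ℓ ^ 2 ≤ ℓ ^ 8 := pow_le_pow_right₀ hℓ (by norm_num)
  have hℓ4 : ℓ ^ 4 ≤ ℓ ^ 8 := pow_le_pow_right₀ hℓ (by norm_num)
  have hℓ6 : ℓ ^ 6 ≤ ℓ ^ 8 := pow_le_pow_right₀ hℓ (by norm_num)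
  have hK4_1 : 1 ≤ K ^ 4 := one_le_pow₀ hK
  have hK4_0 : 0 ≤ K ^ 4 := by positivity
  have hℓ8_0 : 0 ≤ ℓ ^ 8 := by positivity
  have hM0 : 0 ≤ K ^ 4 * ℓ ^ 8 * w := by positivity
  -- unit bounds `X ≤ K⁴ℓ⁸w`
  have u24 : K ^ 2 * ℓ ^ 4 * w ≤ K ^ 4 * ℓ ^ 8 * w :=
    mul_le_mul_of_nonneg_right (mul_le_mul hK2 hℓ4 (by positivity) hK4_0) hw0
  have u36 : K ^ 3 * ℓ ^ 6 * w ≤ K ^ 4 * ℓ ^ 8 * w :=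
    mul_le_mul_of_nonneg_right (mul_le_mul hK3 hℓ6 (by positivity) hK4_0) hw0
  have u02 : ℓ ^ 2 * w ≤ K ^ 4 * ℓ ^ 8 * w := by
    have : ℓ ^ 2 ≤ K ^ 4 * ℓ ^ 8 := by nlinarith
    exact mul_le_mul_of_nonneg_right this hw0
  -- the nine summands
  have s1 : (β * T ^ 2) * d ^ 2 ≤ K ^ 2 * ℓ ^ 4 * w := mul_le_mul hβT hd2w (sq_nonneg _) (by positivity)
  have s2 : (β * T ^ 2) * d ≤ K ^ 2 * ℓ ^ 4 * w := mul_le_mul hβT hdw hd0 (by positivity)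
  have s3 : x * (β * rf ^ 2) ≤ ℓ ^ 2 * w := by
    calc x * (β * rf ^ 2) ≤ w * ℓ ^ 2 := mul_le_mul hxw hβrf hB0 hw0
      _ = ℓ ^ 2 * w := by ring
  have s4 : d * (β * rf ^ 2) ≤ ℓ ^ 2 * w := by
    calc d * (β * rf ^ 2) ≤ w * ℓ ^ 2 := mul_le_mul hdw hβrf hB0 hw0
      _ = ℓ ^ 2 * w := by ring
  have s5 : (β * T ^ 2) * w ≤ K ^ 2 * ℓ ^ 4 * w := mul_le_mul_of_nonneg_right hβT hw0
  have hT2 : T ^ 2 ≤ K ^ 2 * ℓ ^ 4 * w := by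
    calc T ^ 2 ≤ (K * (x * ℓ ^ 2)) ^ 2 := pow_le_pow_left₀ hT0 hT 2
      _ = K ^ 2 * ℓ ^ 4 * x ^ 2 := by ring
      _ ≤ K ^ 2 * ℓ ^ 4 * w := mul_le_mul_of_nonneg_left hx2w (by positivity)
  have hT1 : T ≤ K * ℓ ^ 2 * w := by
    calc T ≤ K * (x * ℓ ^ 2) := hT
      _ = K * ℓ ^ 2 * x := by ring
      _ ≤ K * ℓ ^ 2 * w := mul_le_mul_of_nonneg_left hxw (by positivity)
  have s6 : (β * T ^ 2) * T ≤ K ^ 3 * ℓ ^ 6 * w := by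
    calc (β * T ^ 2) * T ≤ (K ^ 2 * ℓ ^ 4) * (K * ℓ ^ 2 * w) := mul_le_mul hβT hT1 hT0 (by positivity)
      _ = K ^ 3 * ℓ ^ 6 * w := by ring
  have s7 : (β * T ^ 2) * T ^ 2 ≤ K ^ 4 * ℓ ^ 8 * w := by
    calc (β * T ^ 2) * T ^ 2 ≤ (K ^ 2 * ℓ ^ 4) * (K ^ 2 * ℓ ^ 4 * w) := mul_le_mul hβT hT2 (sq_nonneg _) (by positivity)
      _ = K ^ 4 * ℓ ^ 8 * w := by ring
  -- lift every summand to the common unit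
  have t1 : (β * T ^ 2) * d ^ 2 ≤ K ^ 4 * ℓ ^ 8 * w := s1.trans u24
  have t2 : (β * T ^ 2) * d ≤ K ^ 4 * ℓ ^ 8 * w := s2.trans u24
  have t3 : x * (β * rf ^ 2) ≤ K ^ 4 * ℓ ^ 8 * w := s3.trans u02
  have t4 : d * (β * rf ^ 2) ≤ K ^ 4 * ℓ ^ 8 * w := s4.trans u02
  have t5 : (β * T ^ 2) * w ≤ K ^ 4 * ℓ ^ 8 * w := s5.trans u24
  have t6 : (β * T ^ 2) * T ≤ K ^ 4 * ℓ ^ 8 * w := s6.trans u36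
  linarith [mul_le_mul_of_nonneg_left t1 (by positivity : (0:ℝ) ≤ 558 * E), mul_le_mul_of_nonneg_left t2 (by positivity : (0:ℝ) ≤ 192 * E),
    mul_le_mul_of_nonneg_left t3 (by positivity : (0:ℝ) ≤ 100 * N), mul_le_mul_of_nonneg_left t4 (by positivity : (0:ℝ) ≤ 5040 * N),
    mul_le_mul_of_nonneg_left t5 (by positivity : (0:ℝ) ≤ 3456 * P), mul_le_mul_of_nonneg_left t6 (by positivity : (0:ℝ) ≤ 88128 * P),
    mul_le_mul_of_nonneg_left s7 (by positivity : (0:ℝ) ≤ 2101707 * P)]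

/-- ★★ **THE REPAIRED EXPONENT IS `O(ℓ⁸β^{-1/4})`**: with the action window `σ := powScale (1/2) β` (input window, `T`, `r_f`, `Γ` as in the record),
`η₀'(β) ≤ (45L+1)⁴·ℓ⁸·powScale (1/4) β·(750|E| + 5140N₃ + 2193291N_P)` for `β ≥ 1`. [cite: Luscher1983, §3] -/
theorem repaired_recordExponent_le {β : ℝ} (hβ : 1 ≤ β) :
    coreEta L β 0 (powScale (1 / 3) β) (9 * (L : ℝ) * (5 * (powScale (1 / 2) β * btLog β ^ 2)) + powScale 1 β)
          (min (1 / 40) (powScale (1 / 2) β * btLog β)) (powScale 1 β * Fintype.card (Site 3 L)) (powScale (1 / 2) β) +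
        coreEps1 L β 0 (9 * (L : ℝ) * (5 * (powScale (1 / 2) β * btLog β ^ 2)) + powScale 1 β) (min (1 / 40) (powScale (1 / 2) β * btLog β)) +
        coreEps2 L β 0 (9 * (L : ℝ) * (5 * (powScale (1 / 2) β * btLog β ^ 2)) + powScale 1 β) (min (1 / 40) (powScale (1 / 2) β * btLog β))
          (powScale (1 / 2) β) ≤
      (45 * (L : ℝ) + 1) ^ 4 * btLog β ^ 8 * powScale (1 / 4) β *
        (750 * (Fintype.card (Edge 3 L) : ℝ) + 5140 * (Fintype.card (Plaquette 3 L × Fin 3) : ℝ) + 2193291 * (Fintype.card (Plaquette 3 L) : ℝ)) := by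
  obtain ⟨hw0, hw1, hx, hsx, hd0, hdw, hd1, hβx⟩ := scale_facts hβ
  have hℓ : 1 ≤ btLog β := one_le_btLog β
  have hL : (1 : ℝ) ≤ (L : ℝ) := by exact_mod_cast Nat.one_le_iff_ne_zero.mpr (NeZero.ne L)
  have hK : (1 : ℝ) ≤ 45 * (L : ℝ) + 1 := by linarith
  have hT0 := R52.schedT_nonneg (L := L) β
  have hT := schedT_le (L := L) hβ
  have hβT := R52.beta_schedT_sq_le (L := L) hβ
  have hrf0 : 0 ≤ min (1 / 40) (powScale (1 / 2) β * btLog β) :=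
    le_min (by norm_num) (mul_pos (powScale_pos _ _) (lt_of_lt_of_le one_pos hℓ)).le
  have hβrf : β * min (1 / 40) (powScale (1 / 2) β * btLog β) ^ 2 ≤ btLog β ^ 2 := by
    have h1 : min (1 / 40) (powScale (1 / 2) β * btLog β) ^ 2 ≤ (powScale (1 / 2) β * btLog β) ^ 2 :=
      pow_le_pow_left₀ hrf0 (min_le_right _ _) 2
    calc β * min (1 / 40) (powScale (1 / 2) β * btLog β) ^ 2 ≤ β * (powScale (1 / 2) β * btLog β) ^ 2 :=
          mul_le_mul_of_nonneg_left h1 (by linarith)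
      _ = (β * powScale (1 / 2) β ^ 2) * btLog β ^ 2 := by ring
      _ = btLog β ^ 2 := by rw [hβx, one_mul]
  have hsN : Real.sqrt (Fintype.card (Plaquette 3 L × Fin 3) : ℝ) ^ 2 = (Fintype.card (Plaquette 3 L × Fin 3) : ℝ) :=
    Real.sq_sqrt (Nat.cast_nonneg _)
  have hform :
      coreEta L β 0 (powScale (1 / 3) β) (9 * (L : ℝ) * (5 * (powScale (1 / 2) β * btLog β ^ 2)) + powScale 1 β)
            (min (1 / 40) (powScale (1 / 2) β * btLog β)) (powScale 1 β * Fintype.card (Site 3 L)) (powScale (1 / 2) β) +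
          coreEps1 L β 0 (9 * (L : ℝ) * (5 * (powScale (1 / 2) β * btLog β ^ 2)) + powScale 1 β) (min (1 / 40) (powScale (1 / 2) β * btLog β)) +
          coreEps2 L β 0 (9 * (L : ℝ) * (5 * (powScale (1 / 2) β * btLog β ^ 2)) + powScale 1 β) (min (1 / 40) (powScale (1 / 2) β * btLog β))
            (powScale (1 / 2) β) =
        558 * (Fintype.card (Edge 3 L) : ℝ) * (β * (9 * (L : ℝ) * (5 * (powScale (1 / 2) β * btLog β ^ 2)) + powScale 1 β) ^ 2) * powScale (1 / 3) β ^ 2 +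
          192 * (Fintype.card (Edge 3 L) : ℝ) * (β * (9 * (L : ℝ) * (5 * (powScale (1 / 2) β * btLog β ^ 2)) + powScale 1 β) ^ 2) * powScale (1 / 3) β +
          50 * (Fintype.card (Plaquette 3 L × Fin 3) : ℝ) * powScale (1 / 2) β * (β * min (1 / 40) (powScale (1 / 2) β * btLog β) ^ 2) +
          50 * Real.sqrt (Fintype.card (Plaquette 3 L × Fin 3) : ℝ) ^ 2 * powScale (1 / 2) β * (β * min (1 / 40) (powScale (1 / 2) β * btLog β) ^ 2) +
          5040 * (Fintype.card (Plaquette 3 L × Fin 3) : ℝ) * powScale (1 / 3) β * (β * min (1 / 40) (powScale (1 / 2) β * btLog β) ^ 2) +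
          3456 * (Fintype.card (Plaquette 3 L) : ℝ) * (β * (9 * (L : ℝ) * (5 * (powScale (1 / 2) β * btLog β ^ 2)) + powScale 1 β) ^ 2) * powScale (1 / 4) β +
          88128 * (Fintype.card (Plaquette 3 L) : ℝ) * (β * (9 * (L : ℝ) * (5 * (powScale (1 / 2) β * btLog β ^ 2)) + powScale 1 β) ^ 2) *
            (9 * (L : ℝ) * (5 * (powScale (1 / 2) β * btLog β ^ 2)) + powScale 1 β) +
          2101707 * (Fintype.card (Plaquette 3 L) : ℝ) * (β * (9 * (L : ℝ) * (5 * (powScale (1 / 2) β * btLog β ^ 2)) + powScale 1 β) ^ 2) *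
            (9 * (L : ℝ) * (5 * (powScale (1 / 2) β * btLog β ^ 2)) + powScale 1 β) ^ 2 := by
    unfold coreEta coreEps1 coreEps2 stepActionErr
    rw [Real.sqrt_zero, hsx]
    ring
  rw [hform, hsN]
  have key := exponent_poly_bound (E := (Fintype.card (Edge 3 L) : ℝ)) (N := (Fintype.card (Plaquette 3 L × Fin 3) : ℝ))
    (P := (Fintype.card (Plaquette 3 L) : ℝ)) hℓ hK (Nat.cast_nonneg _) (Nat.cast_nonneg _) (Nat.cast_nonneg _) hw0.le hw1 hx hd0.le hd1 hdw hβ hT0 hT hβT hβrf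
  linarith [key]

/-- ★★ **THE REPAIRED EXPONENT FITS THE (OD) BUDGET** (`σ := powScale (1/2) β`; every `ε, θ > 0`): `∃ β₀ ∀ β ≥ β₀ ∃ b, η₀'(β) ≤ b ∧ b² ≤ εθλ_b(L³β)/16`
(R50T `polylog_window_affordable`, `m = 8`, `s = 1/4 > 1/6`; `ℓ = log β` for `β ≥ e`). [cite: Luscher1983, §3] -/
theorem repaired_recordExponent_affordable {ε θ : ℝ} (hε : 0 < ε) (hθ : 0 < θ) :
    ∃ β0 : ℝ, ∀ β : ℝ, β0 ≤ β → ∃ b : ℝ,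
      coreEta L β 0 (powScale (1 / 3) β) (9 * (L : ℝ) * (5 * (powScale (1 / 2) β * btLog β ^ 2)) + powScale 1 β)
            (min (1 / 40) (powScale (1 / 2) β * btLog β)) (powScale 1 β * Fintype.card (Site 3 L)) (powScale (1 / 2) β) +
          coreEps1 L β 0 (9 * (L : ℝ) * (5 * (powScale (1 / 2) β * btLog β ^ 2)) + powScale 1 β) (min (1 / 40) (powScale (1 / 2) β * btLog β)) +
          coreEps2 L β 0 (9 * (L : ℝ) * (5 * (powScale (1 / 2) β * btLog β ^ 2)) + powScale 1 β) (min (1 / 40) (powScale (1 / 2) β * btLog β))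
            (powScale (1 / 2) β) ≤ b ∧
        b ^ 2 ≤ ε * θ * bareLambda ((L : ℝ) ^ 3 * β) / 16 := by
  have hA : 0 ≤ (45 * (L : ℝ) + 1) ^ 4 *
      (750 * (Fintype.card (Edge 3 L) : ℝ) + 5140 * (Fintype.card (Plaquette 3 L × Fin 3) : ℝ) + 2193291 * (Fintype.card (Plaquette 3 L) : ℝ)) := by positivity
  obtain ⟨β0, h⟩ := R50T.polylog_window_affordable (L := L) (s := 1 / 4)
    (A := (45 * (L : ℝ) + 1) ^ 4 *
      (750 * (Fintype.card (Edge 3 L) : ℝ) + 5140 * (Fintype.card (Plaquette 3 L × Fin 3) : ℝ) + 2193291 * (Fintype.card (Plaquette 3 L) : ℝ)))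
    8 (by norm_num) hA hε hθ
  obtain ⟨βe, hβe⟩ := Filter.eventually_atTop.mp (eventually_btLog_eq)
  refine ⟨max (max β0 βe) 1, fun β hβ => ?_⟩
  have hβ0 : β0 ≤ β := le_trans (le_trans (le_max_left _ _) (le_max_left _ _)) hβ
  have hβe' : βe ≤ β := le_trans (le_trans (le_max_right _ _) (le_max_left _ _)) hβ
  have hβ1 : 1 ≤ β := le_trans (le_max_right _ _) hβ
  obtain ⟨b, hb, hb2⟩ := h β hβ0
  refine ⟨b, le_trans (repaired_recordExponent_le (L := L) hβ1) (le_trans (le_of_eq ?_) hb), hb2⟩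
  rw [hβe β hβe']; ring

/-- ★★ **… AND MEETS `hb_small` WITH `b_OD := η₀'` ITSELF**: `∀ a > 0, ∀ᶠ β, η₀'(β)² ≤ a·λ_b(L³β)`. [cite: Luscher1983, §3] -/
theorem repaired_recordExponent_hb_small :
    ∀ a : ℝ, 0 < a → ∀ᶠ β : ℝ in atTop,
      (coreEta L β 0 (powScale (1 / 3) β) (9 * (L : ℝ) * (5 * (powScale (1 / 2) β * btLog β ^ 2)) + powScale 1 β)
            (min (1 / 40) (powScale (1 / 2) β * btLog β)) (powScale 1 β * Fintype.card (Site 3 L)) (powScale (1 / 2) β) +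
          coreEps1 L β 0 (9 * (L : ℝ) * (5 * (powScale (1 / 2) β * btLog β ^ 2)) + powScale 1 β) (min (1 / 40) (powScale (1 / 2) β * btLog β)) +
          coreEps2 L β 0 (9 * (L : ℝ) * (5 * (powScale (1 / 2) β * btLog β ^ 2)) + powScale 1 β) (min (1 / 40) (powScale (1 / 2) β * btLog β))
            (powScale (1 / 2) β)) ^ 2 ≤ a * bareLambda ((L : ℝ) ^ 3 * β) := by
  intro a ha
  obtain ⟨β0, h⟩ := repaired_recordExponent_affordable (L := L) (ε := 16 * a) (θ := 1) (by linarith) one_pos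
  refine Filter.eventually_atTop.mpr ⟨max β0 0, fun β hβ => ?_⟩
  obtain ⟨b, hb, hb2⟩ := h β ((le_max_left _ _).trans hβ)
  have h0 := recordExponent_nonneg (L := L) (σ := powScale (1 / 2) β) ((le_max_right _ _).trans hβ) (powScale_pos _ _).le
  calc _ ≤ b ^ 2 := pow_le_pow_left₀ h0 hb 2
    _ ≤ 16 * a * 1 * bareLambda ((L : ℝ) ^ 3 * β) / 16 := hb2
    _ = a * bareLambda ((L : ℝ) ^ 3 * β) := by ring

/-- Exponents and constants: the repair `σ = β^{-1/2}` has `√σ = β^{-1/4}`, `1/4 > 1/6`; the whole repaired exponent is `O(β^{-1/4}ℓ⁸)`;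
`2·1728 + 3·29376 + 3·700569 = 2193291` (`stepActionErr T σ` twice, `stepActionErr T 0` once, all `β`-weighted), `558 + 192 = 750`, `50 + 50 + 5040 = 5140`. [folklore] -/
example : (1 : ℝ) / 2 / 2 = 1 / 4 ∧ (1 : ℝ) / 6 < 1 / 4 ∧ (2 : ℝ) * 1728 + 3 * 29376 + 3 * 700569 = 2193291 ∧
    (558 : ℝ) + 192 = 750 ∧ (50 : ℝ) + 50 + 5040 = 5140 := by norm_num

end Summit.QuantumFields.YangMills.Theorems.TwistedTraceScaling.Negative.R53R

end
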